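import Mathlib.CategoryTheory.Limits.FunctorCategory.Basic
import Mathlib.CategoryTheory.Adjunction.Limits
import Mathlib.CategoryTheory.Limits.Preserves.Shapes.Equalizers
import Literature.AnabelianGeometry.SemiGraphs.CechNerve
import Literature.AnabelianGeometry.SemiGraphs.BTempCoequalizers
import HarnessLib

/-!
# Semi-graphs of anabelioids, Appendix, Theorem A.4: the Čech extension `ψ^*` as a CONCRETE quotient
# (parallel convention `A ⨯ X`)

Mochizuki, *Semi-graphs of anabelioids*, Publ. RIMS **42** (2006) 221–322, Appendix, Theorem A.4 and its
proof (manuscript pp. 82–86, PRIMS pp. 312–316) [cite: MochizukiSemiAnbd2006, Thm A.4 pp.82-86]: from a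
morphism of quasi-temperoids `φ : T₁[A₁] → T₂[A₂]` the proof constructs `ψ^* : T₂ → T₁` with
`λ₁ ∘ φ^* ≅ ψ^* ∘ λ₂` and checks that `ψ^*` "preserves countable colimits (respectively, fibered
products)".  Row A4-∃ of the abc-iut cell's `plan/L3/SUBDAG-SemiAnbd-Cor311.md` (the Čech route, owner
abc-iut-w4-d110) takes for `ψ^*` the CHOICE-FREE extension
`ψ^*(X) := coeq( K(q₁), K(q₂) : K(A₂ ⨯ (A₂ ⨯ X)) ⇉ K(A₂ ⨯ X) )`, `K := φ^* ⋙ λ₁`, along the Čech pair of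
`A₂ ⨯ X → X` (`CechNerve.lean`).  This file is the `B^temp(Π₁)`-valued CONCRETE form of that
construction — `ψ^*(X)` is the explicit quotient `BTemp.coeqObj` (`BTempCoequalizers.lean`), so that the
finite-limit clause can be checked ON POINTS (`QuasiTemperoidsThmA4CechLimits.lean`):

* `cechExt K : T₂ ⥤ B^temp(Π₁)` for any `K : T₂[A₂] ⥤ B^temp(Π₁)` and any `T₂` with binary products,
  with structure arrows `cechExtπ`, their universal property `cechExtIsColimit`, surjectivity and the
  kernel description on points (`cechExtπ_surjective`, `cechExtπ_eq_iff`);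
* the 1-commutation `cechExtIso : λ₂ ⋙ cechExt K ≅ K` (when `K` preserves coequalizers and the Čech
  coforks are coequalizers in `T₂[A₂]` — in `B^temp` they are, `BTempCechCofork.lean`);
* `preservesColimitsOfShape_cechExt` — `ψ^*` preserves the colimits that `K(A₂ ⨯ −)`,
  `K(A₂ ⨯ (A₂ ⨯ −))` preserve (`cechExt ≅ cechDiagram ⋙ colim`; colimits commute with coequalizers).

PARALLEL FILES (α22 of the L3 lead, "both stacks run"): the generic `colim`-valued form of the same
construction is abc-iut-w4-d081's `ThmA4CechPresentation.lean` / abc-iut-L3-t5's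
`QuasiTemperoidsThmA4CechExtension.lean` (convention `X ⨯ A`); this file is independent of them and
restates none of their declarations.  Nothing refers to the IUT corpus beyond [SemiAnbd]; no side is
taken on any disputed claim.
-/

open CategoryTheory CategoryTheory.Limits

namespace Literature.AnabelianGeometry.SemiGraphs

universe w w' v₂ u u₂

section CechExtension

variable {T₂ : Type u₂} [Category.{v₂} T₂] [HasBinaryProducts T₂] (A₂ : T₂)
variable {G₁ : Type u} [Group G₁] [TopologicalSpace G₁] [IsTopologicalGroup G₁]
variable (K : Over' A₂ ⥤ BTemp G₁)

/-- The arrow `K(A₂ ⨯ f) ≫ π_Y` coequalises `K(q₁), K(q₂)` (naturality of the faces), so that it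
descends to `ψ^*(X) → ψ^*(Y)`. [cite: MochizukiSemiAnbd2006, Thm A.4 proof pp.85-86] -/
theorem cechExt_map_aux {X Y : T₂} (f : X ⟶ Y) :
    K.map ((cechFst A₂).app X) ≫ K.map ((cechZero A₂).map f) ≫
        BTemp.coeqπ (K.map ((cechFst A₂).app Y)) (K.map ((cechSnd A₂).app Y)) =
      K.map ((cechSnd A₂).app X) ≫ K.map ((cechZero A₂).map f) ≫
        BTemp.coeqπ (K.map ((cechFst A₂).app Y)) (K.map ((cechSnd A₂).app Y)) := by
  have h₁ : K.map ((cechOne A₂).map f) ≫ K.map ((cechFst A₂).app Y) =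
      K.map ((cechFst A₂).app X) ≫ K.map ((cechZero A₂).map f) := by
    rw [← K.map_comp, (cechFst A₂).naturality, K.map_comp]
  have h₂ : K.map ((cechOne A₂).map f) ≫ K.map ((cechSnd A₂).app Y) =
      K.map ((cechSnd A₂).app X) ≫ K.map ((cechZero A₂).map f) := by
    rw [← K.map_comp, (cechSnd A₂).naturality, K.map_comp]
  rw [← Category.assoc, ← h₁, Category.assoc, BTemp.coeq_condition, ← Category.assoc, h₂,
    Category.assoc]

/-- **The Čech extension `ψ^* : T₂ ⥤ B^temp(Π₁)` of `K : T₂[A₂] ⥤ B^temp(Π₁)`**: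
`X ↦ coeq(K(q₁), K(q₂) : K(A₂ ⨯ (A₂ ⨯ X)) ⇉ K(A₂ ⨯ X))` — the construction of the functor `ψ^*`
of Thm. A.4 directly from the presentation of `X` by the objects `A₂ ⨯ X`, `A₂ ⨯ (A₂ ⨯ X)` of `T₂[A₂]`
(the same presentation the uniqueness clause uses); on arrows by descent.
[cite: MochizukiSemiAnbd2006, Thm A.4 proof pp.85-86] -/
noncomputable def cechExt : T₂ ⥤ BTemp G₁ where
  obj X := BTemp.coeqObj (K.map ((cechFst A₂).app X)) (K.map ((cechSnd A₂).app X))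
  map {X Y} f := BTemp.coeqDesc _ _ (K.map ((cechZero A₂).map f) ≫ BTemp.coeqπ _ _)
    (cechExt_map_aux A₂ K f)
  map_id X := by
    apply BTemp.coeq_hom_ext
    rw [BTemp.coeqπ_desc, (cechZero A₂).map_id, K.map_id, Category.id_comp, Category.comp_id]
  map_comp f g := by
    apply BTemp.coeq_hom_ext
    rw [BTemp.coeqπ_desc, (cechZero A₂).map_comp, K.map_comp, Category.assoc]
    symm
    rw [← Category.assoc, BTemp.coeqπ_desc, Category.assoc, BTemp.coeqπ_desc]

/-- The structure arrow `π_X : K(A₂ ⨯ X) → ψ^*(X)`. [cite: MochizukiSemiAnbd2006, Thm A.4 proof pp.85-86] -/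
noncomputable def cechExtπ (X : T₂) : K.obj ((cechZero A₂).obj X) ⟶ (cechExt A₂ K).obj X :=
  BTemp.coeqπ _ _

/-- `π` is natural: `π_X ≫ ψ^*(f) = K(A₂ ⨯ f) ≫ π_Y`. [cite: MochizukiSemiAnbd2006, Thm A.4 proof pp.85-86] -/
@[reassoc] theorem cechExtπ_map {X Y : T₂} (f : X ⟶ Y) :
    cechExtπ A₂ K X ≫ (cechExt A₂ K).map f = K.map ((cechZero A₂).map f) ≫ cechExtπ A₂ K Y :=
  BTemp.coeqπ_desc _ _ _ (cechExt_map_aux A₂ K f)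

/-- `K(q₁) ≫ π = K(q₂) ≫ π`. [cite: MochizukiSemiAnbd2006, Thm A.4 proof pp.85-86] -/
@[reassoc] theorem cechExt_condition (X : T₂) :
    K.map ((cechFst A₂).app X) ≫ cechExtπ A₂ K X = K.map ((cechSnd A₂).app X) ≫ cechExtπ A₂ K X :=
  BTemp.coeq_condition _ _

/-- `π_X` is a coequalizer of `K(q₁), K(q₂)`. [cite: MochizukiSemiAnbd2006, Thm A.4 proof pp.85-86] -/
noncomputable def cechExtIsColimit (X : T₂) :
    IsColimit (Cofork.ofπ (cechExtπ A₂ K X) (cechExt_condition A₂ K X)) :=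
  BTemp.coeqIsColimit _ _

/-- Arrows out of `ψ^*(X)` are determined by their composite with `π_X`.
[cite: MochizukiSemiAnbd2006, Thm A.4 proof pp.85-86] -/
theorem cechExt_hom_ext {X : T₂} {W : BTemp G₁} {χ χ' : (cechExt A₂ K).obj X ⟶ W}
    (h : cechExtπ A₂ K X ≫ χ = cechExtπ A₂ K X ≫ χ') : χ = χ' :=
  BTemp.coeq_hom_ext _ _ h

/-- Every point of `ψ^*(X)` comes from a point of `K(A₂ ⨯ X)`. [cite: MochizukiSemiAnbd2006, Thm A.4 proof pp.85-86] -/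
theorem cechExtπ_surjective (X : T₂) (z : ((cechExt A₂ K).obj X).obj.V) :
    ∃ v, ((cechExtπ A₂ K X).hom.hom v : ((cechExt A₂ K).obj X).obj.V) = z :=
  BTemp.coeqπ_surjective _ _ z

/-- Two points of `K(A₂ ⨯ X)` have the same image in `ψ^*(X)` iff they are related by the
equivalence relation generated by `K(q₁)(w) ~ K(q₂)(w)`. [cite: MochizukiSemiAnbd2006, Thm A.4 proof pp.85-86] -/
theorem cechExtπ_eq_iff (X : T₂) {v v' : (K.obj ((cechZero A₂).obj X)).obj.V} :
    ((cechExtπ A₂ K X).hom.hom v : ((cechExt A₂ K).obj X).obj.V) = (cechExtπ A₂ K X).hom.hom v' ↔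
      Relation.EqvGen (BTemp.CoeqRel (K.map ((cechFst A₂).app X)) (K.map ((cechSnd A₂).app X))) v v' :=
  BTemp.coeqπ_eq_iff _ _

/-! ### The comparison `ψ^* ∘ λ₂ ≅ K` on `T₂[A₂]` -/

/-- The Čech cofork of `B ∈ T₂[A₂]` inside `T₂[A₂]`: `A₂ ⨯ (A₂ ⨯ B) ⇉ A₂ ⨯ B → B`.
[cite: MochizukiSemiAnbd2006, Thm A.4 proof pp.85-86] -/
noncomputable def cechCoforkOver (B : Over' A₂) :
    Cofork ((cechFst A₂).app B.obj) ((cechSnd A₂).app B.obj) :=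
  Cofork.ofπ (ObjectProperty.homMk (prod.snd : A₂ ⨯ B.obj ⟶ B.obj))
    (ObjectProperty.hom_ext _ (cechFst_snd A₂ B.obj))

variable [PreservesColimitsOfShape WalkingParallelPair K]

/-- **`ψ^*(λ₂ B) ≅ K B` for `B ∈ T₂[A₂]`**, when the Čech cofork of `B` is a coequalizer in `T₂[A₂]`
and `K` preserves coequalizers: both `π_B` and `K(A₂ ⨯ B → B)` are coequalizers of `K(q₁), K(q₂)`.
[cite: MochizukiSemiAnbd2006, Thm A.4 proof pp.85-86] -/
noncomputable def cechExtObjIso (B : Over' A₂) (hB : IsColimit (cechCoforkOver A₂ B)) :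
    (cechExt A₂ K).obj B.obj ≅ K.obj B :=
  IsColimit.coconePointUniqueUpToIso (cechExtIsColimit A₂ K B.obj)
    (isColimitCoforkMapOfIsColimit K _ hB)

/-- The comparison isomorphism is compatible with the structure arrows: `π_B ≫ ≅ = K(A₂ ⨯ B → B)`.
[cite: MochizukiSemiAnbd2006, Thm A.4 proof pp.85-86] -/
@[reassoc] theorem cechExtπ_objIso_hom (B : Over' A₂) (hB : IsColimit (cechCoforkOver A₂ B)) :
    cechExtπ A₂ K B.obj ≫ (cechExtObjIso A₂ K B hB).hom =
      K.map (ObjectProperty.homMk (prod.snd : A₂ ⨯ B.obj ⟶ B.obj)) :=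
  IsColimit.comp_coconePointUniqueUpToIso_hom (cechExtIsColimit A₂ K B.obj) _ WalkingParallelPair.one

/-- **The 1-commutation `λ₂ ⋙ ψ^* ≅ K`** (natural in `B ∈ T₂[A₂]`), assuming every Čech cofork is a
coequalizer in `T₂[A₂]`. [cite: MochizukiSemiAnbd2006, Thm A.4 proof pp.85-86] -/
noncomputable def cechExtIso (hcoeq : ∀ B : Over' A₂, IsColimit (cechCoforkOver A₂ B)) :
    (admitsHomTo A₂).ι ⋙ cechExt A₂ K ≅ K :=
  NatIso.ofComponents (fun B => cechExtObjIso A₂ K B (hcoeq B)) (fun {B B'} h => by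
    apply cechExt_hom_ext
    change cechExtπ A₂ K B.obj ≫ (cechExt A₂ K).map h.hom ≫ (cechExtObjIso A₂ K B' (hcoeq B')).hom =
      cechExtπ A₂ K B.obj ≫ (cechExtObjIso A₂ K B (hcoeq B)).hom ≫ K.map h
    rw [cechExtπ_map_assoc, cechExtπ_objIso_hom, cechExtπ_objIso_hom_assoc, ← K.map_comp,
      ← K.map_comp]
    congr 1
    apply ObjectProperty.hom_ext
    simp)

/-! ### `ψ^*` preserves the colimits that `K(A₂ ⨯ −)` and `K(A₂ ⨯ (A₂ ⨯ −))` preserve -/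

omit [PreservesColimitsOfShape WalkingParallelPair K] in
/-- The Čech diagram functor `X ↦ (K(q₁), K(q₂) : K(A₂ ⨯ (A₂ ⨯ X)) ⇉ K(A₂ ⨯ X))`.
[cite: MochizukiSemiAnbd2006, Thm A.4 proof pp.85-86] -/
noncomputable def cechDiagram : T₂ ⥤ (WalkingParallelPair ⥤ BTemp G₁) where
  obj X := parallelPair (K.map ((cechFst A₂).app X)) (K.map ((cechSnd A₂).app X))
  map {X Y} f := parallelPairHom _ _ _ _ (K.map ((cechOne A₂).map f)) (K.map ((cechZero A₂).map f))
    (by rw [← K.map_comp, ← K.map_comp, (cechFst A₂).naturality])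
    (by rw [← K.map_comp, ← K.map_comp, (cechSnd A₂).naturality])
  map_id X := by
    ext j
    cases j <;> simp
  map_comp f g := by
    ext j
    cases j <;> simp

variable [HasColimitsOfShape WalkingParallelPair (BTemp G₁)]

omit [PreservesColimitsOfShape WalkingParallelPair K] in
/-- `ψ^* ≅ colim ∘ (Čech diagram)`. [cite: MochizukiSemiAnbd2006, Thm A.4 proof pp.85-86] -/
noncomputable def cechDiagramColimIso : cechDiagram A₂ K ⋙ colim ≅ cechExt A₂ K :=
  NatIso.ofComponents
    (fun X => IsColimit.coconePointUniqueUpToIso (colimit.isColimit _) (cechExtIsColimit A₂ K X))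
    (fun {X Y} f => by
      apply Cofork.IsColimit.hom_ext (colimit.isColimit ((cechDiagram A₂ K).obj X))
      have eX : colimit.ι ((cechDiagram A₂ K).obj X) WalkingParallelPair.one ≫
          (IsColimit.coconePointUniqueUpToIso (colimit.isColimit _) (cechExtIsColimit A₂ K X)).hom =
          cechExtπ A₂ K X :=
        IsColimit.comp_coconePointUniqueUpToIso_hom (colimit.isColimit _) (cechExtIsColimit A₂ K X)
          WalkingParallelPair.one
      have eY : colimit.ι ((cechDiagram A₂ K).obj Y) WalkingParallelPair.one ≫
          (IsColimit.coconePointUniqueUpToIso (colimit.isColimit _) (cechExtIsColimit A₂ K Y)).hom =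
          cechExtπ A₂ K Y :=
        IsColimit.comp_coconePointUniqueUpToIso_hom (colimit.isColimit _) (cechExtIsColimit A₂ K Y)
          WalkingParallelPair.one
      change colimit.ι ((cechDiagram A₂ K).obj X) WalkingParallelPair.one ≫
          colimMap ((cechDiagram A₂ K).map f) ≫
            (IsColimit.coconePointUniqueUpToIso (colimit.isColimit _) (cechExtIsColimit A₂ K Y)).hom =
        colimit.ι ((cechDiagram A₂ K).obj X) WalkingParallelPair.one ≫
          (IsColimit.coconePointUniqueUpToIso (colimit.isColimit _) (cechExtIsColimit A₂ K X)).hom ≫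
            (cechExt A₂ K).map f
      rw [ι_colimMap_assoc, eY, reassoc_of% eX]
      exact (cechExtπ_map A₂ K f).symm)

omit [PreservesColimitsOfShape WalkingParallelPair K] in
/-- **`ψ^*` preserves colimits of shape `J`** as soon as `X ↦ K(A₂ ⨯ X)` and `X ↦ K(A₂ ⨯ (A₂ ⨯ X))`
do (colimits commute with coequalizers). [cite: MochizukiSemiAnbd2006, Thm A.4 proof pp.85-86] -/
theorem preservesColimitsOfShape_cechExt (J : Type w) [Category.{w'} J] [HasColimitsOfShape J (BTemp G₁)]
    [PreservesColimitsOfShape J (cechZero A₂ ⋙ K)] [PreservesColimitsOfShape J (cechOne A₂ ⋙ K)] :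
    PreservesColimitsOfShape J (cechExt A₂ K) := by
  have h : PreservesColimitsOfShape J (cechDiagram A₂ K) := by
    apply preservesColimitsOfShape_of_evaluation
    intro j
    cases j
    · exact preservesColimitsOfShape_of_natIso
        (Iso.refl _ : cechOne A₂ ⋙ K ≅ cechDiagram A₂ K ⋙ (evaluation _ _).obj WalkingParallelPair.zero)
    · exact preservesColimitsOfShape_of_natIso
        (Iso.refl _ : cechZero A₂ ⋙ K ≅ cechDiagram A₂ K ⋙ (evaluation _ _).obj WalkingParallelPair.one)
  haveI := h
  exact preservesColimitsOfShape_of_natIso (cechDiagramColimIso A₂ K)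

end CechExtension

end Literature.AnabelianGeometry.SemiGraphs
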